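import Summits.CriticalPhenomena.PercolationContinuityZ3.Theorems.PercNearOneGluingNoHeavyLowerTailKnDesignationTwoRelays
import Literature.Probability.Percolation.KozmaNitzanClusterPropertyReal
import HarnessLib

/-!
# Pocket-designated Conjecture 4 for two relays: for every monotone cluster property `F` and every decreasing pocket
# event `D`, `E[F(C_c); D] ≤ E[F(C_a); D]` implies `∫_{o↔{a,c}} F(C_c) ≤ ∫_{o↔{a,c}} F(C_o)`

Helper for crux `PercNearOneGluingNoHeavy.NoHeavyLowerTail` (item stmt-CriticalPhenomena-4575, closed), lemma factory
prim-lf-2 (deletion–contraction), gen 14.  No definitions, no named facts, no sorries; standard axioms.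

Kozma–Nitzan's Conjecture 4 (arXiv:2401.12397 p. 32; a theorem in the tree, `Q7Psi.kn_conj4_designated`) says that for a
monotone real cluster property `F` the relay `c` of least mean `E F(C_c)` satisfies `∫_{o↔A} F(C_c) ≤ ∫_{o↔A} F(C_o)`; its
two-relay case is (GΨ₂) (`Q7Psi.gpsi_two`).  THIS FILE is the functional form of the pocket-designation theorem
`KnQ8.block41_pair_of_downEvent` (the case `F = 1{b ∈ ·}`): the designation may be computed ON ANY DECREASING POCKET EVENT
`D = {C_o ∈ 𝒟}` (`𝒟` down-closed, its sets missing `c`) — e.g. `{o ↮ A}` (the functional analogue of Question 8),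
`{o isolated}` (of Question 9), `{o ↮ T}` for a vertex cut `T`:

* `KnQ8.gpsi_pair_of_downEvent` — for `F` monotone on vertex sets, `a ≠ c`, `o ≠ c`: if `∫_D F(C_c) ≤ ∫_D F(C_a)` and
  `μ({c↮a}∩{c↮o}∩D) > 0` then `∫_{{o↔a}∪{o↔c}} F(C_c) ≤ ∫_{{o↔a}∪{o↔c}} F(C_o)`.
  PROOF — the four steps of `block41_pair_of_downEvent` with functions in place of events, every correlation inequality
  taken from the tree in FUNCTIONAL form: (0) on `{c↔a}`, `C_c = C_a`, and `D ⊆ {o↮c}`, so the hypothesis lives on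
  `N ∩ D`, `N = {C_c ∩ {a,o} = ∅}`; (1) `(∫_N F(C_c))·μ(N∩D) ≤ μ(N)·∫_{N∩D} F(C_c)` (`OffCluster.offClusterAssoc`: `F(C_c)`
  increasing in the cluster, `1_D` decreasing off it); (2) `μ(N)·∫_{N∩D} F(C_a) ≤ (∫_N F(C_a))·μ(N∩D)`
  (`OffCluster.offClusterAssoc_mixed`: off the cluster of `c`, `F(C_a)` is increasing and `1_D` decreasing); hence
  `∫_N F(C_c) ≤ ∫_N F(C_a)`; (3) transfer onto `N ∩ {a↔o}` by vdBHK Thm 1.5 given `N` in functional form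
  (`rbhk_twoCluster_avoid`, twice: `F(C_c)` against `1{a↔o}` negatively, `F(C_a)` with `1{a↔o}` positively);
  (4) on `{o↔c}` resp. `N ∩ {a↔o}` the clusters `C_c` resp. `C_a` coincide with `C_o`.
* `KnQ8.gpsi_pair_of_avoid_lt_one` — the `T`-family (`D = {o↮T}`, `c ∈ T ∌ o`) on graphs without weight-`1` pairs.
[cite: KozmaNitzan2024, Conjecture 4 (p. 32), Questions 7–9 (§5.5 p. 36), Lemma 3 (pp. 6–7)]
[cite: VandenbergHaggstromKahn2005, Thms. 1.3–1.5 (pp. 6–8), proof of Thm. 1.5 (pp. 7–8)]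
-/

noncomputable section

namespace Summit.CriticalPhenomena.PercolationContinuityZ3.Theorems

open MeasureTheory Set
open Literature.Probability.LatticeModels (prodBernoulli)
open Literature.Probability.Percolation
open Summit.CriticalPhenomena.PercolationContinuityZ3.Cruxes.AdditiveGluing.TieLine
open scoped Classical

namespace KnQ8

variable {V : Type*} [Fintype V]

/-- Splitting a set integral along an event (finite space: everything is integrable). [folklore] -/
theorem setIntegral_split (μ : Measure (BondConfig V)) [IsFiniteMeasure μ] (S T : Set (BondConfig V))
    (f : BondConfig V → ℝ) :
    ∫ ω in S, f ω ∂μ = (∫ ω in S ∩ T, f ω ∂μ) + ∫ ω in S \ T, f ω ∂μ := by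
  rw [integral_inter_add_sdiff (MeasurableSet.of_discrete : MeasurableSet T) (Integrable.of_finite).integrableOn]

/-- The indicator of a predicate times a function, integrated over `N`, is the set integral over `N ∩ {p}`. [folklore] -/
theorem setIntegral_ite_mul (μ : Measure (BondConfig V)) (N : Set (BondConfig V)) (p : BondConfig V → Prop)
    (f : BondConfig V → ℝ) :
    ∫ ω in N, (if p ω then (1 : ℝ) else 0) * f ω ∂μ = ∫ ω in N ∩ {ω | p ω}, f ω ∂μ := by
  have h : (fun ω => (if p ω then (1 : ℝ) else 0) * f ω) = fun ω => f ω * ({ω | p ω} : Set (BondConfig V)).indicator 1 ω := by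
    funext ω
    by_cases hp : p ω
    · rw [if_pos hp, indicator_of_mem (show ω ∈ {ω | p ω} from hp), Pi.one_apply]; ring
    · rw [if_neg hp, indicator_of_notMem (show ω ∉ {ω | p ω} from hp)]; ring
  rw [h, KNPreFKG.setIntegral_mul_indicator_one]

/-- **Pocket-designated (GΨ₂) / Conjecture 4 for two relays.**  `F` monotone on vertex sets; `a ≠ c`, `o ≠ c`; `𝒟` a
down-closed family of vertex sets missing `c`, `D = {C_o ∈ 𝒟}`.  If `∫_D F(C_c) ≤ ∫_D F(C_a)` and `μ({c↮a}∩{c↮o}∩D) > 0` then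
`∫_{{o↔a}∪{o↔c}} F(C_c) ≤ ∫_{{o↔a}∪{o↔c}} F(C_o)`.  (`F = 1{b ∈ ·}` is `KnQ8.block41_pair_of_downEvent`; `D` = everything would be
(GΨ₂), but is excluded by `c ∉ S ∈ 𝒟` — take `𝒟 = {S | c ∉ S}` and Lemma 3(ii) instead.)
[cite: KozmaNitzan2024, Conjecture 4 (p. 32), Questions 8–9 (§5.5 p. 36)] [cite: VandenbergHaggstromKahn2005, Thms. 1.3–1.5 (pp. 6–8)] -/
theorem gpsi_pair_of_downEvent (w : Sym2 V → unitInterval) (o a c : V) (hac : a ≠ c) (hoc : o ≠ c)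
    (F : Set V → ℝ) (hF : ∀ S T : Set V, S ⊆ T → F S ≤ F T)
    (𝒟 : Set (Set V)) (h𝒟 : ∀ S S' : Set V, S ⊆ S' → S' ∈ 𝒟 → S ∈ 𝒟) (hc𝒟 : ∀ S ∈ 𝒟, c ∉ S)
    (hmin : ∫ ω in {ω : BondConfig V | openCluster ω o ∈ 𝒟}, F (openCluster ω c) ∂(prodBernoulli w) ≤
      ∫ ω in {ω : BondConfig V | openCluster ω o ∈ 𝒟}, F (openCluster ω a) ∂(prodBernoulli w))
    (hpos : 0 < (prodBernoulli w).real
      ({ω : BondConfig V | ¬ (openGraph ω).Reachable c a} ∩ {ω | ¬ (openGraph ω).Reachable c o} ∩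
        {ω | openCluster ω o ∈ 𝒟})) :
    ∫ ω in (openConn o a ∪ openConn o c), F (openCluster ω c) ∂(prodBernoulli w) ≤
      ∫ ω in (openConn o a ∪ openConn o c), F (openCluster ω o) ∂(prodBernoulli w) := by
  set μ := prodBernoulli w with hμ
  set X : Set V := {a, o} with hX
  set N : Set (BondConfig V) := {ω | ∀ x ∈ X, ¬ (openGraph ω).Reachable c x} with hN
  set D : Set (BondConfig V) := {ω | openCluster ω o ∈ 𝒟} with hD
  set U : Set (BondConfig V) := openConn o a ∪ openConn o c with hU
  set Q : Set (BondConfig V) := openConn a o with hQ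
  have hNiff : ∀ ω : BondConfig V, ω ∈ N ↔ ¬ (openGraph ω).Reachable c a ∧ ¬ (openGraph ω).Reachable c o := by
    intro ω
    simp only [hN, hX, mem_setOf_eq, mem_insert_iff, mem_singleton_iff, forall_eq_or_imp, forall_eq]
  have haX : a ∈ X := by simp [hX]
  have hoX : o ∈ X := by simp [hX]
  have hcX : c ∉ X := by
    simp only [hX, mem_insert_iff, mem_singleton_iff, not_or]
    exact ⟨fun h => hac h.symm, fun h => hoc h.symm⟩
  have hDoc : ∀ ω : BondConfig V, ω ∈ D → ¬ (openGraph ω).Reachable c o := by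
    intro ω hω h; exact hc𝒟 _ hω (show c ∈ openCluster ω o from h.symm)
  set fc : BondConfig V → ℝ := fun ω => F (openCluster ω c) with hfc
  set fa : BondConfig V → ℝ := fun ω => F (openCluster ω a) with hfa
  set fo : BondConfig V → ℝ := fun ω => F (openCluster ω o) with hfo
  -- ### (0) the hypothesis on `N ∩ D`
  have eD1 : D ∩ (openConn c a : Set (BondConfig V)) = D ∩ openConn c a := rfl
  have eD2 : D \ (openConn c a : Set (BondConfig V)) = N ∩ D := by
    ext ω
    simp only [mem_sdiff, mem_inter_iff, hNiff, openConn, mem_setOf_eq]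
    constructor
    · rintro ⟨hd, hnca⟩; exact ⟨⟨hnca, hDoc ω hd⟩, hd⟩
    · rintro ⟨⟨hnca, -⟩, hd⟩; exact ⟨hd, hnca⟩
  have hsame : ∫ ω in D ∩ openConn c a, fc ω ∂μ = ∫ ω in D ∩ openConn c a, fa ω ∂μ := by
    refine setIntegral_congr_fun MeasurableSet.of_discrete fun ω hω => ?_
    simp only [hfc, hfa]
    rw [KNPreFKG.openCluster_eq_of_reachable (show (openGraph ω).Reachable c a from hω.2)]
  have h0 : ∫ ω in N ∩ D, fc ω ∂μ ≤ ∫ ω in N ∩ D, fa ω ∂μ := by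
    have h := hmin
    change ∫ ω in D, fc ω ∂μ ≤ ∫ ω in D, fa ω ∂μ at h
    rw [setIntegral_split μ D (openConn c a) fc, setIntegral_split μ D (openConn c a) fa, hsame, eD2] at h
    linarith
  -- ### (1) `F(C_c)` and `1_D` are positively correlated given `N`
  -- the off-cluster readings
  set Fc : Set (Sym2 V) → Set (Sym2 V) → ℝ := fun C _ => F {y | y = c ∨ ∃ e ∈ C, y ∈ e} with hFc
  set GD : Set (Sym2 V) → Set (Sym2 V) → ℝ := fun _ E => if {y | (openGraph E).Reachable o y} ∈ 𝒟 then (1 : ℝ) else 0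
    with hGD
  set Fa : Set (Sym2 V) → Set (Sym2 V) → ℝ := fun _ E => F {y | (openGraph E).Reachable a y} with hFa
  have hFc1 : ∀ E, Monotone fun C => Fc C E := fun _ => KNPreFKG.monotone_clusterFun c F hF
  have hFc2 : ∀ C, Antitone fun E => Fc C E := fun _ => antitone_const
  have hGD1 : ∀ E, Monotone fun C => GD C E := fun _ => monotone_const
  have hGD2 : ∀ C, Antitone fun E => GD C E := by
    intro C E E' hEE'
    show (if {y | (openGraph E').Reachable o y} ∈ 𝒟 then (1 : ℝ) else 0) ≤ if {y | (openGraph E).Reachable o y} ∈ 𝒟 then 1 else 0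
    by_cases h' : {y | (openGraph E').Reachable o y} ∈ 𝒟
    · have hE : {y | (openGraph E).Reachable o y} ∈ 𝒟 :=
        h𝒟 {y | (openGraph E).Reachable o y} {y | (openGraph E').Reachable o y}
          (fun y hy => SimpleGraph.Reachable.mono (BHK2006.openGraph_le hEE') hy) h'
      rw [if_pos h', if_pos hE]
    · rw [if_neg h']; split_ifs <;> norm_num
  have hFa1 : ∀ E, Antitone fun C => Fa C E := fun _ => antitone_const
  have hFa2 : ∀ C, Monotone fun E => Fa C E :=
    fun _ E E' hEE' => hF _ _ fun y hy => SimpleGraph.Reachable.mono (BHK2006.openGraph_le hEE') hy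
  -- readings on `N`
  set Boff : BondConfig V → Set (Sym2 V) := fun ω => ω \ {e | ∃ v ∈ e, v = c ∨ ∃ e' ∈ openEdgeCluster ω c, v ∈ e'} with hBoff
  have rFc : ∀ ω, Fc (openEdgeCluster ω c) (Boff ω) = fc ω := by
    intro ω; simp only [hFc, hfc]; exact KNPreFKG.clusterFun_openEdgeCluster F ω c
  have rGD : ∀ ω ∈ N, GD (openEdgeCluster ω c) (Boff ω) = if ω ∈ D then (1 : ℝ) else 0 := by
    intro ω hω
    simp only [hGD, hBoff]
    rw [openCluster_off_eq ω o c (fun h => ((hNiff ω).1 hω).2 h.symm)]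
    rfl
  have rFa : ∀ ω ∈ N, Fa (openEdgeCluster ω c) (Boff ω) = fa ω := by
    intro ω hω
    simp only [hFa, hfa, hBoff]
    rw [openCluster_off_eq ω a c (fun h => ((hNiff ω).1 hω).1 h.symm)]
  have hNm : MeasurableSet N := MeasurableSet.of_discrete
  have iFc : ∫ ω in N, Fc (openEdgeCluster ω c) (Boff ω) ∂μ = ∫ ω in N, fc ω ∂μ :=
    setIntegral_congr_fun hNm fun ω _ => rFc ω
  have hDm : MeasurableSet D := MeasurableSet.of_discrete
  have iGD : ∫ ω in N, GD (openEdgeCluster ω c) (Boff ω) ∂μ = μ.real (N ∩ D) := by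
    rw [setIntegral_congr_fun hNm (g := D.indicator (1 : BondConfig V → ℝ)) fun ω hω => by
      rw [rGD ω hω]
      by_cases h : ω ∈ D
      · rw [if_pos h, indicator_of_mem h, Pi.one_apply]
      · rw [if_neg h, indicator_of_notMem h]]
    rw [setIntegral_indicator hDm]
    simp only [Pi.one_apply, setIntegral_const, smul_eq_mul, mul_one]
  have iFcGD : ∫ ω in N, Fc (openEdgeCluster ω c) (Boff ω) * GD (openEdgeCluster ω c) (Boff ω) ∂μ =
      ∫ ω in N ∩ D, fc ω ∂μ := by
    rw [setIntegral_congr_fun hNm fun ω hω => by rw [rFc ω, rGD ω hω, mul_comm]]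
    exact setIntegral_ite_mul μ N (fun ω => ω ∈ D) fc
  have iFa : ∫ ω in N, Fa (openEdgeCluster ω c) (Boff ω) ∂μ = ∫ ω in N, fa ω ∂μ :=
    setIntegral_congr_fun hNm fun ω hω => rFa ω hω
  have iFaGD : ∫ ω in N, Fa (openEdgeCluster ω c) (Boff ω) * GD (openEdgeCluster ω c) (Boff ω) ∂μ =
      ∫ ω in N ∩ D, fa ω ∂μ := by
    rw [setIntegral_congr_fun hNm fun ω hω => by rw [rFa ω hω, rGD ω hω, mul_comm]]
    exact setIntegral_ite_mul μ N (fun ω => ω ∈ D) fa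
  have h1 := OffCluster.offClusterAssoc w c X hcX Fc GD hFc1 hFc2 hGD1 hGD2
  have h2 := OffCluster.offClusterAssoc_mixed w c X hcX Fa GD hFa1 hFa2 hGD1 hGD2
  change (∫ ω in N, Fc (openEdgeCluster ω c) (Boff ω) ∂μ) * (∫ ω in N, GD (openEdgeCluster ω c) (Boff ω) ∂μ) ≤
    μ.real N * ∫ ω in N, Fc (openEdgeCluster ω c) (Boff ω) * GD (openEdgeCluster ω c) (Boff ω) ∂μ at h1
  change μ.real N * (∫ ω in N, Fa (openEdgeCluster ω c) (Boff ω) * GD (openEdgeCluster ω c) (Boff ω) ∂μ) ≤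
    (∫ ω in N, Fa (openEdgeCluster ω c) (Boff ω) ∂μ) * ∫ ω in N, GD (openEdgeCluster ω c) (Boff ω) ∂μ at h2
  rw [iFc, iGD, iFcGD] at h1
  rw [iFaGD, iFa, iGD] at h2
  -- `h1 : (∫_N fc) μ(N∩D) ≤ μ(N) ∫_{N∩D} fc`, `h2 : μ(N) ∫_{N∩D} fa ≤ (∫_N fa) μ(N∩D)`
  have hpos' : 0 < μ.real (N ∩ D) := by
    have e : N ∩ D = {ω : BondConfig V | ¬ (openGraph ω).Reachable c a} ∩ {ω | ¬ (openGraph ω).Reachable c o} ∩ D := by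
      ext ω; simp only [mem_inter_iff, hNiff, mem_setOf_eq, and_assoc]
    rw [e]; exact hpos
  have hMpos : 0 < μ.real N := hpos'.trans_le (measureReal_mono inter_subset_left)
  have hN : ∫ ω in N, fc ω ∂μ ≤ ∫ ω in N, fa ω ∂μ := by
    have h3 : μ.real N * ∫ ω in N ∩ D, fc ω ∂μ ≤ μ.real N * ∫ ω in N ∩ D, fa ω ∂μ :=
      mul_le_mul_of_nonneg_left h0 hMpos.le
    exact le_of_mul_le_mul_right (h1.trans (h3.trans h2)) hpos'
  -- ### (3) transfer onto `N ∩ {a↔o}` (vdBHK Thm 1.5 given `N`, functional form)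
  set IQ : Set (Sym2 V) → ℝ := fun C => if (o = a ∨ ∃ e ∈ C, o ∈ e) then (1 : ℝ) else 0 with hIQ
  have hIQmono : Monotone IQ := by
    intro C C' hCC'
    show (if (o = a ∨ ∃ e ∈ C, o ∈ e) then (1 : ℝ) else 0) ≤ if (o = a ∨ ∃ e ∈ C', o ∈ e) then 1 else 0
    by_cases h : o = a ∨ ∃ e ∈ C, o ∈ e
    · rw [if_pos h, if_pos (h.imp id fun ⟨e, he, hoe⟩ => ⟨e, hCC' he, hoe⟩)]
    · rw [if_neg h]; split_ifs <;> norm_num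
  have rIQ : ∀ ω, IQ (openEdgeCluster ω a) = if ω ∈ Q then (1 : ℝ) else 0 := by
    intro ω
    simp only [hIQ, hQ, openConn, mem_setOf_eq, reachable_iff_exists_mem_openEdgeCluster ω a o]
  set Gc : Set (Sym2 V) → ℝ := fun C => F {y | y = c ∨ ∃ e ∈ C, y ∈ e} with hGc
  set Ga : Set (Sym2 V) → ℝ := fun C => F {y | y = a ∨ ∃ e ∈ C, y ∈ e} with hGa
  have hGcm : Monotone Gc := KNPreFKG.monotone_clusterFun c F hF
  have hGam : Monotone Ga := KNPreFKG.monotone_clusterFun a F hF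
  -- (neg): `1_Q(C_a)` and `−F(C_c)`
  have hneg := rbhk_twoCluster_avoid w c a X haX hcX (fun C _ => IQ C) (fun _ Ct => -Gc Ct)
    (fun _ => hIQmono) (fun _ => antitone_const) (fun _ => monotone_const) (fun _ _ _ h => neg_le_neg (hGcm h))
  -- (pos): `F(C_a)` and `1_Q(C_a)`
  have hposc := rbhk_twoCluster_avoid w c a X haX hcX (fun C _ => Ga C) (fun C _ => IQ C)
    (fun _ => hGam) (fun _ => antitone_const) (fun _ => hIQmono) (fun _ => antitone_const)
  have rGc : ∀ ω, Gc (openEdgeCluster ω c) = fc ω := fun ω => KNPreFKG.clusterFun_openEdgeCluster F ω c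
  have rGa : ∀ ω, Ga (openEdgeCluster ω a) = fa ω := fun ω => KNPreFKG.clusterFun_openEdgeCluster F ω a
  have hQm : MeasurableSet Q := MeasurableSet.of_discrete
  have jIQ : ∫ ω in N, IQ (openEdgeCluster ω a) ∂μ = μ.real (N ∩ Q) := by
    rw [setIntegral_congr_fun hNm (g := Q.indicator (1 : BondConfig V → ℝ)) fun ω _ => by
      rw [rIQ ω]
      by_cases h : ω ∈ Q
      · rw [if_pos h, indicator_of_mem h, Pi.one_apply]
      · rw [if_neg h, indicator_of_notMem h]]
    rw [setIntegral_indicator hQm]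
    simp only [Pi.one_apply, setIntegral_const, smul_eq_mul, mul_one]
  have jGc : ∫ ω in N, -Gc (openEdgeCluster ω c) ∂μ = -∫ ω in N, fc ω ∂μ := by
    rw [integral_neg, setIntegral_congr_fun hNm fun ω _ => rGc ω]
  have jIQGc : ∫ ω in N, IQ (openEdgeCluster ω a) * -Gc (openEdgeCluster ω c) ∂μ = -∫ ω in N ∩ Q, fc ω ∂μ := by
    rw [setIntegral_congr_fun hNm fun ω _ => by rw [rIQ ω, rGc ω, mul_neg], integral_neg,
      setIntegral_ite_mul μ N (fun ω => ω ∈ Q) fc]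
    rfl
  have jGa : ∫ ω in N, Ga (openEdgeCluster ω a) ∂μ = ∫ ω in N, fa ω ∂μ := setIntegral_congr_fun hNm fun ω _ => rGa ω
  have jGaIQ : ∫ ω in N, Ga (openEdgeCluster ω a) * IQ (openEdgeCluster ω a) ∂μ = ∫ ω in N ∩ Q, fa ω ∂μ := by
    rw [setIntegral_congr_fun hNm fun ω _ => by rw [rIQ ω, rGa ω, mul_comm], setIntegral_ite_mul μ N (fun ω => ω ∈ Q) fa]
    rfl
  change (∫ ω in N, IQ (openEdgeCluster ω a) ∂μ) * (∫ ω in N, -Gc (openEdgeCluster ω c) ∂μ) ≤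
    μ.real N * ∫ ω in N, IQ (openEdgeCluster ω a) * -Gc (openEdgeCluster ω c) ∂μ at hneg
  change (∫ ω in N, Ga (openEdgeCluster ω a) ∂μ) * (∫ ω in N, IQ (openEdgeCluster ω a) ∂μ) ≤
    μ.real N * ∫ ω in N, Ga (openEdgeCluster ω a) * IQ (openEdgeCluster ω a) ∂μ at hposc
  rw [jIQ, jGc, jIQGc] at hneg
  rw [jGa, jIQ, jGaIQ] at hposc
  -- `hneg : μ(N∩Q)·(−∫_N fc) ≤ μ(N)·(−∫_{N∩Q} fc)`, `hposc : (∫_N fa) μ(N∩Q) ≤ μ(N) ∫_{N∩Q} fa`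
  have hNQ0 : 0 ≤ μ.real (N ∩ Q) := measureReal_nonneg
  have h3 : ∫ ω in N ∩ Q, fc ω ∂μ ≤ ∫ ω in N ∩ Q, fa ω ∂μ := by
    have h4 : μ.real N * ∫ ω in N ∩ Q, fc ω ∂μ ≤ μ.real (N ∩ Q) * ∫ ω in N, fc ω ∂μ := by nlinarith [hneg]
    have h5 : μ.real (N ∩ Q) * ∫ ω in N, fc ω ∂μ ≤ μ.real (N ∩ Q) * ∫ ω in N, fa ω ∂μ :=
      mul_le_mul_of_nonneg_left hN hNQ0
    have h6 : μ.real (N ∩ Q) * ∫ ω in N, fa ω ∂μ ≤ μ.real N * ∫ ω in N ∩ Q, fa ω ∂μ := by nlinarith [hposc]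
    exact le_of_mul_le_mul_left (h4.trans (h5.trans h6)) hMpos
  -- ### (4) bookkeeping
  have hm : MeasurableSet (openConn o c : Set (BondConfig V)) := MeasurableSet.of_discrete
  have e1 : ∫ ω in U ∩ openConn o c, fc ω ∂μ = ∫ ω in U ∩ openConn o c, fo ω ∂μ := by
    refine setIntegral_congr_fun MeasurableSet.of_discrete fun ω hω => ?_
    simp only [hfc, hfo]
    rw [KNPreFKG.openCluster_eq_of_reachable (show (openGraph ω).Reachable c o from (hω.2 : (openGraph ω).Reachable o c).symm)]
  have eNQ : U \ (openConn o c : Set (BondConfig V)) = N ∩ Q := by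
    ext ω
    simp only [mem_sdiff, mem_inter_iff, hU, mem_union, hNiff, hQ, openConn, mem_setOf_eq]
    constructor
    · rintro ⟨hoa | hoc', hnoc⟩
      · exact ⟨⟨fun hca => hnoc (hoa.trans hca.symm), fun hco => hnoc hco.symm⟩, hoa.symm⟩
      · exact absurd hoc' hnoc
    · rintro ⟨⟨hnca, hnco⟩, hao⟩
      exact ⟨Or.inl hao.symm, fun h => hnco h.symm⟩
  have e2 : ∫ ω in N ∩ Q, fa ω ∂μ = ∫ ω in N ∩ Q, fo ω ∂μ := by
    refine setIntegral_congr_fun MeasurableSet.of_discrete fun ω hω => ?_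
    simp only [hfa, hfo]
    rw [KNPreFKG.openCluster_eq_of_reachable (show (openGraph ω).Reachable a o from hω.2)]
  rw [setIntegral_split μ U (openConn o c) fc, setIntegral_split μ U (openConn o c) fo, e1, eNQ]
  rw [e2] at h3
  linarith

/-- **Pocket-designated (GΨ₂), `T`-family, no weight-`1` pairs**: `F` monotone, `a ≠ c`, `o ≠ c`, `T ∋ c`, `o ∉ T`, all
weights `< 1`: `∫_{o↮T} F(C_c) ≤ ∫_{o↮T} F(C_a) ⟹ ∫_{{o↔a}∪{o↔c}} F(C_c) ≤ ∫_{{o↔a}∪{o↔c}} F(C_o)`.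
[cite: KozmaNitzan2024, Conjecture 4 (p. 32), Questions 8–9 (§5.5 p. 36)] -/
theorem gpsi_pair_of_avoid_lt_one (w : Sym2 V → unitInterval) (hw : ∀ e, w e < 1) (o a c : V) (hac : a ≠ c)
    (hoc : o ≠ c) (F : Set V → ℝ) (hF : ∀ S T : Set V, S ⊆ T → F S ≤ F T) (T : Set V) (hcT : c ∈ T) (hoT : o ∉ T)
    (hmin : ∫ ω in {ω : BondConfig V | ∀ t ∈ T, ¬ (openGraph ω).Reachable o t}, F (openCluster ω c) ∂(prodBernoulli w) ≤
      ∫ ω in {ω : BondConfig V | ∀ t ∈ T, ¬ (openGraph ω).Reachable o t}, F (openCluster ω a) ∂(prodBernoulli w)) :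
    ∫ ω in (openConn o a ∪ openConn o c), F (openCluster ω c) ∂(prodBernoulli w) ≤
      ∫ ω in (openConn o a ∪ openConn o c), F (openCluster ω o) ∂(prodBernoulli w) := by
  set 𝒟 : Set (Set V) := {S | ∀ t ∈ T, t ∉ S} with h𝒟def
  have eD : {ω : BondConfig V | openCluster ω o ∈ 𝒟} = {ω | ∀ t ∈ T, ¬ (openGraph ω).Reachable o t} := by
    ext ω; simp only [mem_setOf_eq, h𝒟def, openCluster]
  have h𝒟 : ∀ S S' : Set V, S ⊆ S' → S' ∈ 𝒟 → S ∈ 𝒟 := fun S S' hSS' hS' t ht hts => hS' t ht (hSS' hts)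
  have hc𝒟 : ∀ S ∈ 𝒟, c ∉ S := fun S hS hcS => hS c hcT hcS
  refine gpsi_pair_of_downEvent w o a c hac hoc F hF 𝒟 h𝒟 hc𝒟 (by rw [eD]; exact hmin) ?_
  rw [eD]
  refine real_pos_of_empty_mem w hw ?_
  simp only [mem_inter_iff, mem_setOf_eq, reachable_empty_iff]
  exact ⟨⟨fun h => hac h.symm, fun h => hoc h.symm⟩, fun t ht h => hoT (h ▸ ht)⟩

end KnQ8

end Summit.CriticalPhenomena.PercolationContinuityZ3.Theorems

end
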